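import Literature.MathematicalPhysics.QuantumFieldTheory.CubicalChainsPoincareOne
import Literature.MathematicalPhysics.QuantumFieldTheory.CubicalChainsHodge
import HarnessLib

/-!
# The lattice Hodge star on `ℤ⁴` in degrees two and three, and the Poincaré lemma with sup
# bound for closed 3-cochains

Support file for the Coulomb-gas analysis of four-dimensional `U(1)` lattice gauge theory (proof
programme of the named fact
`Literature.MathematicalPhysics.QuantumFieldTheory.FrohlichSpencerU1PerimeterLawD4` and of its
corollary `Literature.Barriers.QuantumFields.AbelianDeconfinementD4`). Fröhlich–Spencer work on the
lattice `(ℤ⁴)*` DUAL to the original one (FS82 §2.3, (2.17)–(2.18): "Given a `k`-cell `c_k ⊂ ℤ^D`,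
let `c*_{D-k}` denote the `(D-k)`-cell in the dual lattice passing through `c_k` … `(*α)(c*) = α(c)`
… `*d* = δ`"), where the monopole current densities `ρ` of the four-dimensional theory — 3-forms
on the original lattice — become 1-forms (currents on links), to which Lemma 1 applies in degree
one. This file provides that dictionary for `ℤ⁴` concretely, with the dual lattice realised as `ℤ⁴`
itself through the reflection `x ↦ -x` (which exchanges forward and backward differences):

* `star₃ Q y l = (-1)^l Q(-y; ĉ_l)` (3-cochains → 1-chains, `ĉ_l` the increasing complement of `l`),
  `star₂ ω y j k = t_{jk} ω(-y; ĉ_{jk})` (2-cochains → alternating 2-chains), with the explicit sign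
  table `t`;
* `bd₁_star₃ : ∂(⋆Q)(y) = (dQ)(-y; 0,1,2,3)` (`⋆d = ∂⋆` in top degree) and
  `bd₂_star₂ : ∂(⋆ω) = ⋆(dω)` (in the middle degree), `star₂_star₂` (`⋆⋆ = 1` on alternating
  2-chains), `star₃` injective on the increasing-triple components;
* `exists_d₂_eq_of_cd₃_eq_zero` (**FS82 Lemma 1 in cochain degree three on `ℤ⁴`, with the sup
  bound**): a 3-cochain `Q` with `cd₃ Q = 0` whose cells lie in a box is `d₂ ω` (on the
  increasing-triple components) for an alternating 2-cochain `ω` supported near the box, with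
  `|ω| ≤ ‖Q‖₁` — by transporting `LatticeChain.exists_bd₂_eq_of_bd₁_eq_zero` through the star;
  `exists_d₂_eq_of_cd₃_apply_eq_zero` is the same statement assuming closedness only on the
  increasing 4-cells `(x; 0, 1, 2, 3)` (all the star reads), for non-alternating data.

Everything is proved; no named fact is introduced.

## References

* J. Fröhlich, T. Spencer, Comm. Math. Phys. 83 (1982) 411–454, §2.3 (2.17)–(2.18) (the lattice
  Hodge star), Lemma 1 (p. 421), (2.56), (2.84). [FrohlichSpencerCMP1982]
-/

noncomputable section

open Finset Function Literature.Probability.LatticeModels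

namespace Literature.MathematicalPhysics.QuantumFieldTheory

namespace LatticeChain

open LatticeForm (e d₂)

/-! ### Complements and signs in `Fin 4` -/

/-- The increasing complement triple of `l ∈ {0,1,2,3}`. [folklore] -/
def compl₃ : Fin 4 → Fin 4 × Fin 4 × Fin 4 := ![(1, 2, 3), (0, 2, 3), (0, 1, 3), (0, 1, 2)]

/-- The increasing complement pair of `{j, k}` (arbitrary on the diagonal). [folklore] -/
def compl₂ : Fin 4 → Fin 4 → Fin 4 × Fin 4 :=
  ![![(0, 0), (2, 3), (1, 3), (1, 2)],
    ![(2, 3), (0, 0), (0, 3), (0, 2)],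
    ![(1, 3), (0, 3), (0, 0), (0, 1)],
    ![(1, 2), (0, 2), (0, 1), (0, 0)]]

/-- The sign `t_{jk} = (-1)^{j+k-[k<j]}` of the middle-degree star (zero on the diagonal).
[folklore] -/
def sgn₂ : Fin 4 → Fin 4 → ℤ :=
  ![![0, -1, 1, -1],
    ![1, 0, -1, 1],
    ![-1, 1, 0, -1],
    ![1, -1, 1, 0]]

/-- The sign `(-1)^l` of the top-degree star. [folklore] -/
def sgn₃ : Fin 4 → ℤ := ![1, -1, 1, -1]

/-! ### The stars -/

/-- **The star of a 3-cochain on `ℤ⁴`**: the 1-chain `(⋆Q)(y, l) = (-1)^l Q(-y; ĉ_l)`.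
[cite: FrohlichSpencerCMP1982, §2.3 (2.17)] -/
def star₃ (Q : Site 4 → Fin 4 → Fin 4 → Fin 4 → ℤ) : Site 4 → Fin 4 → ℤ :=
  fun y l => sgn₃ l * Q (-y) (compl₃ l).1 (compl₃ l).2.1 (compl₃ l).2.2

/-- **The star of a 2-cochain on `ℤ⁴`**: the alternating 2-chain `(⋆ω)(y; j, k) = t_{jk} ω(-y; ĉ_{jk})`.
[cite: FrohlichSpencerCMP1982, §2.3 (2.17)] -/
def star₂ (ω : Site 4 → Fin 4 → Fin 4 → ℤ) : Site 4 → Fin 4 → Fin 4 → ℤ :=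
  fun y j k => sgn₂ j k * ω (-y) (compl₂ j k).1 (compl₂ j k).2

/-- `⋆ω` is alternating. [folklore] -/
theorem isAlt₂_star₂ (ω : Site 4 → Fin 4 → Fin 4 → ℤ) : IsAlt₂ (star₂ ω) := by
  intro y i j
  simp only [star₂]
  fin_cases i <;> fin_cases j <;> simp [sgn₂, compl₂]

/-- **`⋆d = ∂⋆` in the top degree**: `∂(⋆Q)(y) = (dQ)(-y; 0, 1, 2, 3)`. [cite: FrohlichSpencerCMP1982, §2.3 (2.18)] -/
theorem bd₁_star₃ (Q : Site 4 → Fin 4 → Fin 4 → Fin 4 → ℤ) (y : Site 4) :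
    bd₁ (star₃ Q) y = cd₃ Q (-y) 0 1 2 3 := by
  simp only [bd₁, star₃, cd₃, Fin.sum_univ_four, neg_sub', sub_neg_eq_add]
  simp [sgn₃, compl₃]
  ring

/-- **`⋆d = ∂⋆` in the middle degree**: `∂(⋆ω) = ⋆(dω)`. [cite: FrohlichSpencerCMP1982, §2.3 (2.18)] -/
theorem bd₂_star₂ (ω : Site 4 → Fin 4 → Fin 4 → ℤ) : bd₂ (star₂ ω) = star₃ (d₂ ω) := by
  funext y k
  simp only [bd₂, star₂, star₃, LatticeForm.d₂, Fin.sum_univ_four, neg_sub', sub_neg_eq_add]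
  fin_cases k <;> simp [sgn₂, sgn₃, compl₂, compl₃] <;> ring

/-- **`⋆⋆ = 1`** on alternating 2-chains. [folklore] -/
theorem star₂_star₂ (M : Site 4 → Fin 4 → Fin 4 → ℤ) (hM : IsAlt₂ M) : star₂ (star₂ M) = M := by
  funext y j k
  simp only [star₂, neg_neg]
  fin_cases j <;> fin_cases k <;> simp [sgn₂, compl₂] <;>
    linarith [hM y 0 1, hM y 0 2, hM y 0 3, hM y 1 2, hM y 1 3, hM y 2 3, hM.diag y 0,
      hM.diag y 1, hM.diag y 2, hM.diag y 3]

/-- The components of a 3-cochain on the increasing triples determine its star and conversely.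
[folklore] -/
theorem star₃_apply_eq (Q : Site 4 → Fin 4 → Fin 4 → Fin 4 → ℤ) (x : Site 4) (l : Fin 4) :
    Q x (compl₃ l).1 (compl₃ l).2.1 (compl₃ l).2.2 = sgn₃ l * star₃ Q (-x) l := by
  simp only [star₃, neg_neg, ← mul_assoc]
  fin_cases l <;> simp [sgn₃]

/-! ### Lemma 1 in cochain degree three -/

/-- **Closed 3-cochains in a box of `ℤ⁴` are coboundaries of 2-cochains near the box, with the
`ℓ¹ → ℓ^∞` bound — pointwise-closedness form.** As `exists_d₂_eq_of_cd₃_eq_zero` below, but the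
closedness hypothesis is only required on the increasing 4-cells `(x; 0, 1, 2, 3)` (the only
components of `cd₃ Q` the star reads, `bd₁_star₃`); this is the form needed for 3-cochains given
on the increasing triples only (e.g. zero extensions of cube fields of a box), which are not
alternating. [cite: FrohlichSpencerCMP1982, §2.3 Lemma 1 p. 421 with (2.17)–(2.18); (2.56), (2.84)] -/
theorem exists_d₂_eq_of_cd₃_apply_eq_zero (a b : Site 4) (Q : Site 4 → Fin 4 → Fin 4 → Fin 4 → ℤ)
    (hcl : ∀ x, cd₃ Q x 0 1 2 3 = 0)
    (hsupp : ∀ x l, Q x (compl₃ l).1 (compl₃ l).2.1 (compl₃ l).2.2 ≠ 0 → a ≤ x ∧ x ≤ b)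
    (TQ : Finset (Site 4 × Fin 4))
    (hT : ∀ x l, Q x (compl₃ l).1 (compl₃ l).2.1 (compl₃ l).2.2 ≠ 0 → (x, l) ∈ TQ) :
    ∃ ω : Site 4 → Fin 4 → Fin 4 → ℤ, IsAlt₂ ω ∧
      (∀ x l, d₂ ω x (compl₃ l).1 (compl₃ l).2.1 (compl₃ l).2.2 =
        Q x (compl₃ l).1 (compl₃ l).2.1 (compl₃ l).2.2) ∧
      (∀ x i j, ω x i j ≠ 0 → a - 2 ≤ x ∧ x ≤ b + 1) ∧
      ∀ x i j, |ω x i j| ≤ ∑ p ∈ TQ, |Q p.1 (compl₃ p.2).1 (compl₃ p.2).2.1 (compl₃ p.2).2.2| := by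
  classical
  set ρ := star₃ Q with hρ
  -- `ρ` is a closed 1-chain in the reflected box
  have hclρ : bd₁ ρ = 0 := by
    funext y
    rw [hρ, bd₁_star₃, hcl (-y)]
    rfl
  have hρval : ∀ y l, ρ y l ≠ 0 → Q (-y) (compl₃ l).1 (compl₃ l).2.1 (compl₃ l).2.2 ≠ 0 := by
    intro y l h hQ
    exact h (by rw [hρ, star₃, hQ, mul_zero])
  have hsuppρ : ∀ y l, ρ y l ≠ 0 → -b ≤ y ∧ y + e l ≤ -a + 1 := by
    intro y l h
    obtain ⟨ha, hb⟩ := hsupp (-y) l (hρval y l h)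
    refine ⟨by intro m; have := hb m; simp only [Pi.neg_apply] at this ⊢; omega, fun m => ?_⟩
    have := ha m
    simp only [Pi.add_apply, Pi.neg_apply, Pi.one_apply, LatticeForm.e, Pi.single_apply] at this ⊢
    split_ifs <;> omega
  -- transport the finite support set
  set T : Finset (Site 4 × Fin 4) := TQ.image fun p => (-p.1, p.2) with hTdef
  have hTρ : ∀ y l, ρ y l ≠ 0 → (y, l) ∈ T := by
    intro y l h
    refine Finset.mem_image.2 ⟨(-y, l), hT _ _ (hρval y l h), ?_⟩
    simp
  obtain ⟨M, hMalt, hMbd, hMsupp, hMle⟩ :=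
    exists_bd₂_eq_of_bd₁_eq_zero (-b) (-a + 1) ρ hclρ hsuppρ T hTρ
  -- the sum over `T` is the sum over `TQ`
  have hsum : ∑ p ∈ T, |ρ p.1 p.2| =
      ∑ p ∈ TQ, |Q p.1 (compl₃ p.2).1 (compl₃ p.2).2.1 (compl₃ p.2).2.2| := by
    rw [hTdef, Finset.sum_image]
    · refine Finset.sum_congr rfl fun p _ => ?_
      simp only [hρ, star₃, neg_neg, abs_mul]
      have : |sgn₃ p.2| = 1 := by
        generalize p.2 = l
        fin_cases l <;> simp [sgn₃]
      rw [this, one_mul]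
    · intro p _ q _ hpq
      simp only [Prod.mk.injEq, neg_inj] at hpq
      exact Prod.ext hpq.1 hpq.2
  refine ⟨star₂ M, isAlt₂_star₂ M, ?_, ?_, ?_⟩
  · -- `d₂ (⋆M) = Q` on increasing triples: `⋆(d₂ ⋆M) = ∂(⋆⋆M) = ∂M = ρ = ⋆Q`
    intro x l
    have key : star₃ (d₂ (star₂ M)) = star₃ Q := by
      rw [← bd₂_star₂, star₂_star₂ M hMalt, hMbd]
    have := congrFun (congrFun key (-x)) l
    rw [star₃_apply_eq (d₂ (star₂ M)), star₃_apply_eq Q, this]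
  · -- support
    intro x i j h
    have hne : M (-x) (compl₂ i j).1 (compl₂ i j).2 ≠ 0 := by
      intro h0
      exact h (by rw [star₂, h0, mul_zero])
    obtain ⟨h1, h2⟩ := hMsupp _ _ _ hne
    refine ⟨fun m => ?_, fun m => ?_⟩
    · have := h2 m
      simp only [Pi.add_apply, Pi.neg_apply, LatticeForm.e, Pi.single_apply,
        Pi.sub_apply, Pi.ofNat_apply] at this ⊢
      split_ifs at this <;> omega
    · have := h1 m
      simp only [Pi.neg_apply, Pi.add_apply, Pi.one_apply] at this ⊢
      omega
  · -- sup bound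
    intro x i j
    rw [← hsum]
    calc |star₂ M x i j| = |sgn₂ i j| * |M (-x) (compl₂ i j).1 (compl₂ i j).2| := by
          rw [star₂, abs_mul]
      _ ≤ 1 * |M (-x) (compl₂ i j).1 (compl₂ i j).2| := by
          refine mul_le_mul_of_nonneg_right ?_ (abs_nonneg _)
          fin_cases i <;> fin_cases j <;> simp [sgn₂]
      _ = _ := one_mul _
      _ ≤ ∑ p ∈ T, |ρ p.1 p.2| := hMle _ _ _

/-- **Closed 3-cochains in a box of `ℤ⁴` are coboundaries of 2-cochains near the box, with the
`ℓ¹ → ℓ^∞` bound** (Fröhlich–Spencer 1982 Lemma 1 for the monopole current densities of the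
four-dimensional theory, obtained from the degree-one chain statement through the lattice Hodge
star). Let `Q` be an integer 3-cochain on `ℤ⁴` with `cd₃ Q = 0` whose non-zero increasing-triple
components `Q(x; ĉ_l)` have `a ≤ x ≤ b`, and let `TQ ⊇ {(x, l) : Q(x; ĉ_l) ≠ 0}` be finite. Then
there is an alternating integer 2-cochain `ω` with `(d₂ ω)(x; ĉ_l) = Q(x; ĉ_l)` for all `x, l`,
supported on `a - 2 ≤ x ≤ b + 1`, and `|ω(x; i, j)| ≤ ∑_{(x,l) ∈ TQ} |Q(x; ĉ_l)|`.
[cite: FrohlichSpencerCMP1982, §2.3 Lemma 1 p. 421 with (2.17)–(2.18); (2.56), (2.84)] -/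
theorem exists_d₂_eq_of_cd₃_eq_zero (a b : Site 4) (Q : Site 4 → Fin 4 → Fin 4 → Fin 4 → ℤ)
    (hcl : cd₃ Q = 0)
    (hsupp : ∀ x l, Q x (compl₃ l).1 (compl₃ l).2.1 (compl₃ l).2.2 ≠ 0 → a ≤ x ∧ x ≤ b)
    (TQ : Finset (Site 4 × Fin 4))
    (hT : ∀ x l, Q x (compl₃ l).1 (compl₃ l).2.1 (compl₃ l).2.2 ≠ 0 → (x, l) ∈ TQ) :
    ∃ ω : Site 4 → Fin 4 → Fin 4 → ℤ, IsAlt₂ ω ∧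
      (∀ x l, d₂ ω x (compl₃ l).1 (compl₃ l).2.1 (compl₃ l).2.2 =
        Q x (compl₃ l).1 (compl₃ l).2.1 (compl₃ l).2.2) ∧
      (∀ x i j, ω x i j ≠ 0 → a - 2 ≤ x ∧ x ≤ b + 1) ∧
      ∀ x i j, |ω x i j| ≤ ∑ p ∈ TQ, |Q p.1 (compl₃ p.2).1 (compl₃ p.2).2.1 (compl₃ p.2).2.2| :=
  exists_d₂_eq_of_cd₃_apply_eq_zero a b Q (fun x => by rw [hcl]; rfl) hsupp TQ hT

end LatticeChain

end Literature.MathematicalPhysics.QuantumFieldTheory
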